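import Mathlib
import Summits.KontsevichZagierPeriods.KontsevichZagierPeriods.Theorems.TorsionLogsGKZLevelThreePairLogTail
import Summits.KontsevichZagierPeriods.KontsevichZagierPeriods.Theorems.BetaCancellation.Negative.Torsion

/-!
# Route TorsionLogs — support item `GKZLevelThreePair`: the T-chain, step (N5)
# (`[(0,1), 9(1-r)/(1+r³)] ∼ [(1,2), 6/x]`, value `6 log 2`)

Helper file for item `stmt-KontsevichZagierPeriods-13812` (`GKZLevelThreePair`), blueprint v3 (item
evidence `blueprint-13812-v2.md` and NOTES): the 2-dimensional factor
`Trep = [(0,1)², t^{-1/3}(1-t)^{-2/3}(1-y²t)^{-1/3}]` of the level-3 Euler representation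
(value `T = 6 log 2`) descends by explicit moves to `R5 = [(0,1), 9(1-r)/(1+r³)]`
(`9∫₀¹(1-r)dr/(1+r³) = 6 log 2` exactly). This file carries `R5` to `L₆ = [(1,2), 6/x]`:

* `of_oddPart_mem_relations` — `[(0,1), c(2r-1)/(r²-r+1)] ∈ relations`: the reflection `r ↦ 1-r`
  (rule 2)) reverses the sign of the integrand, so twice the class is a relation; and
  `FormalRep ⧸ relations` is torsion-free (`BetaCancellation/Negative/Torsion.lean`);
* `tail5_equivalent_L6` — partial fractions `9(1-r)/(1+r³) = 6/(1+r) - 3(2r-1)/(r²-r+1)`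
  (rule 1b)), the odd part, and `[(0,1), 6/(1+r)] ∼ [(1,2), 6/x]` (rule 2), `x = 1 + r`).

## References

* M. Kontsevich, D. Zagier, *Periods* (2001), §1.1 (`log 2 = ∫₁² dx/x`), §1.2 rules (1), (2).
-/

-- `Summit.<Summit>.<Sub>` with Sub = Summit (single-conjunct summit, D-0017) duplicates the segment.
set_option linter.dupNamespace false

noncomputable section

namespace Summit.KontsevichZagierPeriods.KontsevichZagierPeriods.Theorems.GKZLevelThree

open Set MeasureTheory
open MvPolynomial (aeval X C)
open Literature.NumberTheory.Transcendental Literature.NumberTheory.Transcendental.KZ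
open Literature.ModelTheory.ExponentialFields (IsSemialgebraic isSemialgebraic_setOf_eval_pos)
open Summit.KontsevichZagierPeriods.HermiteRigidity.CMTwistQuasiPeriodTransfer
  (of_sub_of_mem_changeOfVariablesRel_dimOne)
open Summit.KontsevichZagierPeriods.HermiteRigidity.GenusTwoCycleTransfer
  (hasFDerivAt_fin_one det_smul_id_fin_one)
open Summit.KontsevichZagierPeriods.KontsevichZagierPeriods.BetaCancellationNegative
  (mem_relations_of_nsmul_mem)

/-! ## `[(0,1), 9(1-r)/(1+r³)] ∼ [(1,2), 6/x]` -/

/-- `1 + r³ > 0` on `[0,1]` (indeed for `r > -1`). -/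
theorem one_add_cube_pos {r : ℝ} (hr : 0 ≤ r) : 0 < 1 + r ^ 3 := by positivity

/-- `r² - r + 1 > 0`. -/
theorem sq_sub_add_one_pos (r : ℝ) : 0 < r ^ 2 - r + 1 := by nlinarith [sq_nonneg (r - 1/2)]

/-- **The odd part is a relation**: `[(0,1), c(2r-1)/(r²-r+1)] ∈ relations` (`c ∈ ℚ`). The
reflection `r ↦ 1-r` (rule 2)) carries the representation to the one with the opposite integrand, so
twice the class is a relation, and `FormalRep ⧸ relations` is torsion-free.
[Kontsevich–Zagier 2001, §1.2 rules (1), (2)] -/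
theorem of_oddPart_mem_relations (c : ℚ) (O : IntegralRep 1)
    (hOd : O.domain = {x : Fin 1 → ℝ | 0 < x 0 ∧ x 0 < 1})
    (hOi : EqOn O.integrand (fun x => (c : ℝ) * (2 * x 0 - 1) / (x 0 ^ 2 - x 0 + 1)) O.domain) :
    of O ∈ relations := by
  -- the reflected representation `O' = [(0,1), -c(2r-1)/(r²-r+1)]`
  obtain ⟨O', hO'd, hO'i⟩ := exists_ratRep01 (C c - C (2 * c) * X 0) (X 0 ^ 2 - X 0 + 1)
    (fun r => -((c : ℝ) * (2 * r - 1) / (r ^ 2 - r + 1)))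
    (fun r _ => by
      simp only [map_add, map_sub, map_pow, map_one, MvPolynomial.aeval_X, ne_eq]
      exact (sq_sub_add_one_pos r).ne')
    (fun r => by
      simp only [map_add, map_sub, map_mul, map_pow, map_one, MvPolynomial.aeval_C, MvPolynomial.aeval_X,
        eq_ratCast, Rat.cast_ofNat]
      ring)
    (((by fun_prop : Continuous fun r : ℝ => (c : ℝ) * (2 * r - 1)).continuousOn.div (by fun_prop)
      fun r _ => (sq_sub_add_one_pos r).ne').neg)
  -- `O ∼ O'` by the reflection `r ↦ 1 - r`
  have h1 : of O - of O' ∈ relations := by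
    refine of_sub_of_mem_relations_of_boxReflection (0 : Fin 1) ?_ fun x hx => ?_
    · rw [hOd, hO'd]
      ext x
      simp only [mem_setOf_eq, mem_preimage, boxReflection_apply_self]
      constructor <;> rintro ⟨h1, h2⟩ <;> constructor <;> linarith
    · rw [hOi hx, hO'i]
      simp only [boxReflection_apply_self]
      have h := (sq_sub_add_one_pos (x 0)).ne'
      have h' : ((1 - x 0) ^ 2 - (1 - x 0) + 1) ≠ 0 := (sq_sub_add_one_pos (1 - x 0)).ne'
      field_simp
      ring
  -- `O + O' ∼ 0` (opposite integrands on the same domain)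
  have h2 : of O + of O' ∈ relations :=
    of_add_of_mem_relations_of_eqOn_neg (by rw [hO'd, hOd]) fun x hx => by
      rw [hO'i, Pi.neg_apply, hOi hx]
  have h3 : 2 • of O ∈ relations := by
    have : 2 • of O = (of O - of O') + (of O + of O') := by abel
    rw [this]
    exact relations.add_mem h1 h2
  exact mem_relations_of_nsmul_mem (by norm_num) h3

/-- **Step (N5)**: `[(0,1), 9(1-r)/(1+r³)] ∼ [(1,2), 6/x]`. Partial fractions
`9(1-r)/(1+r³) = 6/(1+r) - 3(2r-1)/(r²-r+1)` (rule 1b)), the odd part is a relation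
(`of_oddPart_mem_relations`), and `[(0,1), 6/(1+r)] ∼ [(1,2), 6/x]` by `x = 1 + r` (rule 2)).
Value: `9∫₀¹(1-r)dr/(1+r³) = 6 log 2`. [Kontsevich–Zagier 2001, §1.1–1.2] -/
theorem tail5_equivalent_L6 (R L₆ : IntegralRep 1)
    (hRd : R.domain = {x : Fin 1 → ℝ | 0 < x 0 ∧ x 0 < 1})
    (hRi : EqOn R.integrand (fun x => 9 * (1 - x 0) / (1 + x 0 ^ 3)) R.domain)
    (hLd : L₆.domain = {x : Fin 1 → ℝ | 1 < x 0 ∧ x 0 < 2})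
    (hLi : EqOn L₆.integrand (fun x => 6 / x 0) L₆.domain) : Equivalent R L₆ := by
  obtain ⟨R₆, hR₆d, hR₆i⟩ := exists_ratRep01 (C 6) (1 + X 0) (fun r => 6 / (1 + r))
    (fun r hr => by simp only [map_add, map_one, MvPolynomial.aeval_X, ne_eq]; linarith [hr.1])
    (fun r => by simp)
    (continuousOn_const.div (by fun_prop) fun r hr => by
      have : (0:ℝ) ≤ r := hr.1
      exact ne_of_gt (by linarith))
  -- the odd part with `c = -3`
  obtain ⟨O, hOd, hOi⟩ := exists_ratRep01 (C (-3 : ℚ) * (C 2 * X 0 - 1)) (X 0 ^ 2 - X 0 + 1)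
    (fun r => ((-3 : ℚ) : ℝ) * (2 * r - 1) / (r ^ 2 - r + 1))
    (fun r _ => by
      simp only [map_add, map_sub, map_pow, map_one, MvPolynomial.aeval_X, ne_eq]
      exact (sq_sub_add_one_pos r).ne')
    (fun r => by
      simp only [map_sub, map_mul, map_one, MvPolynomial.aeval_C, MvPolynomial.aeval_X, map_add, map_pow,
        eq_ratCast]
      push_cast
      ring)
    ((by fun_prop : Continuous fun r : ℝ => ((-3 : ℚ) : ℝ) * (2 * r - 1)).continuousOn.div (by fun_prop)
      fun r _ => (sq_sub_add_one_pos r).ne')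
  -- `[R] ≡ [R₆] + [O]` (partial fractions)
  have hsplit : of R - of R₆ - of O ∈ relations := by
    refine integrandAddRel_subset_relations ⟨1, R, R₆, O, by rw [hR₆d, hRd], by rw [hOd, hRd],
      fun x hx => ?_, rfl⟩
    have hx' : 0 < x 0 ∧ x 0 < 1 := by rw [hRd] at hx; exact hx
    rw [hRi hx, Pi.add_apply, hR₆i, hOi]
    have h1 : (1 + x 0) ≠ 0 := by linarith [hx'.1]
    have h2 := (sq_sub_add_one_pos (x 0)).ne'
    have h13 : (1 + x 0 ^ 3) = (1 + x 0) * (x 0 ^ 2 - x 0 + 1) := by ring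
    show 9 * (1 - x 0) / (1 + x 0 ^ 3) = 6 / (1 + x 0) + ((-3 : ℚ) : ℝ) * (2 * x 0 - 1) / (x 0 ^ 2 - x 0 + 1)
    rw [h13, div_add_div _ _ h1 h2, div_eq_div_iff (mul_ne_zero h1 h2) (mul_ne_zero h1 h2)]
    push_cast
    ring
  have hO : of O ∈ relations := of_oddPart_mem_relations (-3) O hOd (fun x _ => by rw [hOi])
  have h6 : Equivalent R₆ L₆ := oneAdd_equivalent_L 6 R₆ L₆ hR₆d (fun x _ => by rw [hR₆i]) hLd hLi
  have e : of R - of L₆ = (of R - of R₆ - of O) + of O + (of R₆ - of L₆) := by abel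
  show of R - of L₆ ∈ relations
  rw [e]
  exact relations.add_mem (relations.add_mem hsplit hO) h6

end Summit.KontsevichZagierPeriods.KontsevichZagierPeriods.Theorems.GKZLevelThree

end
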